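import Summits.NavierStokesRegularity.NavierStokesRegularity.Theorems.TypeIQuarterGateEnvelopeQuarterLawTools
import Summits.NavierStokesRegularity.NavierStokesRegularity.Theorems.SoloSalvageLucardoOlivaes2026Enstrophy
import Summits.NavierStokesRegularity.NavierStokesRegularity.Theorems.TypeILiouvilleTypeIliouvilleNoTypeIIStubGradientSharpOfTypeI
import Literature.Analysis.FluidPDE.BKMClassEnstrophyContinuity
import HarnessLib

/-!
# `TypeIQuarterGate.QuarterLawTypeI` (crux stmt-NavierStokesRegularity-23726), line `lorentz-upgrade`,
# stub `stub_countQuarterLaw` (= item 23971 `CountQuarterLaw`) — THE SPARSE-CORE ENGINE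

Helper file (`--supports stmt-NavierStokesRegularity-23726`; first brick for the registered stub
`stub_countQuarterLaw` of the skeleton `line-lorentz-upgrade` (sha16 a3194bad1babbefe), whose
composition is `stub_lorentzUpgrade → stub_lorentzCount → stub_countQuarterLaw → QuarterLawTypeI`).

The landed item `EnvelopeQuarterLaw` (stmt-23844, `EnvelopeQuarterLaw.main`) derives Leray's quarter
rate `∫ ‖curl u(t)‖² ≤ K/√(T−t)` from the SCAR ENVELOPE by a GLOBAL enstrophy argument whose only use
of the envelope is a per-slice split of `ℝ³` into "cores" of volume `O((T−t)^{3/2})` (where the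
velocity is `O((T−t)^{-1/2})` by the Type-I rate and the vorticity `O((T−t)^{-1})` by KNSS smoothing)
and their complement (where the velocity is `≤ m₀ + μ/√(T−t)` with `μ` SMALL against `√ν`). This
file isolates that mechanism as an ENGINE with the cores abstracted away:

* `slice_stretching_bound_core` — the slice estimate for a `C²` divergence-free field `v` with an
  arbitrary measurable core `G` of volume `≤ R`: `‖v‖ ≤ M` everywhere, `‖v‖ ≤ m` off `G`, `‖Dv‖ ≤ 𝒢`
  give `|∫⟪ω, Dv ω⟫| ≤ (m ‖ω‖₂ + M √6 𝒢 √R) ‖curl ω‖₂` (Lamb form + Cauchy–Schwarz, exactly as in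
  `EnvelopeQuarterLaw.slice_stretching_bound`).
* `quarterLaw_of_sparseCores` — THE ENGINE: a classical Leray–Hopf solution on `[0,T)` from a rapidly
  decaying datum with the sup-norm Type-I rate at `T`, such that for every `t` near `T` some measurable
  set `G_t` of volume `≤ V (T−t)^{3/2}` carries all points where `‖u(t,x)‖ > m₀ + μ/√(T−t)`, with
  `16 μ² ≤ ν`, obeys the quarter law `∫ ‖curl u(t)‖² ≤ K/√(T−t)` on `[0,T)`.
  PROOF = `EnvelopeQuarterLaw.main` verbatim with the envelope replaced by the abstract cores:
  gradient rate `‖∇u(t)‖_∞ ≤ C_g/(T−t)` (tree `GradientPivot.stub_gradientSharp_of_typeI`), enstrophy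
  identity (tree `LucardoOlivaes2026.hasDerivAt_half_ensq` on the Chae/BKM class from
  `RungReynoldsOne.stub_taoCover`), the slice estimate, Young, and `EnvelopeQuarterLaw.gronwall_quarter`
  (the singular coefficient `4μ²/ν ≤ 1/4 < 1/2` is what the smallness of `μ` buys).

USE (line `lorentz-upgrade` / `uniform-count`, stub `stub_countQuarterLaw`): under the scale-uniform
ε-concentration count the cores at time `t` are the `≤ N` doubled concentration balls at the single
scale `λ√(T−t)`, and the off-core bound `μ/√(T−t)` with `μ` small is the one-scale ε-regularity
(dissipation quantum, tree `EnstrophyQuarterLaw.DissipationQuantum.small_of_cknE_le`) under the Type-I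
scaled bounds (tree `scaledEnergies_bounded_of_typeIRate_unif`) — `λ` large makes `μ` small. That
transfer (unit-viscosity rescaling, vertex-`T` cylinders, a.e. → pointwise by continuity) is NOT in
this file.

HONEST FRAMING: bookkeeping along a HYPOTHETICAL Type-I blow-up; nothing here asserts that such a
solution exists, no stub of the skeleton is closed by this file, and nothing about Navier–Stokes
regularity or blow-up is claimed. [folklore; mechanism of KochNadirashviliSereginSverak2009 §4 (4.6)
and Leray 1934 §20]
-/

-- the problem directory repeats the summit name (`NavierStokesRegularity/NavierStokesRegularity`)
set_option linter.dupNamespace false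

noncomputable section

open Set Filter MeasureTheory Topology Metric
open scoped RealInnerProductSpace ENNReal NNReal ContDiff

namespace Summit.NavierStokesRegularity.NavierStokesRegularity.Theorems

namespace CountQuarterLaw

open Literature.Analysis.FluidPDE EnvelopeQuarterLaw

/-! ### The slice estimate with an abstract core -/

/-- **The slice estimate with an abstract core.** For a `C²` divergence-free `v : ℝ³ → ℝ³`, a
measurable set `G` with `|G| ≤ R`, bounds `‖v‖ ≤ M` everywhere and `‖v‖ ≤ m` off `G` (`m, M ≥ 0`),
`‖Dv‖ ≤ 𝒢`, and `curl v ∈ L²`, `|∇ curl v|_F ∈ L²`, integrable stretching density: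
`|∫⟪ω, Dv ω⟫| ≤ (m ‖ω‖₂ + M · √6 𝒢 · √R) · ‖curl ω‖₂` (`ω = curl v`), by the Lamb form
`∫⟪v, ω × curl ω⟫` of the stretching integral split along `G` and Cauchy–Schwarz. [folklore] -/
theorem slice_stretching_bound_core {v : EuclideanSpace ℝ (Fin 3) → EuclideanSpace ℝ (Fin 3)}
    (hv : ContDiff ℝ 2 v) (hdiv : VectorCalculus.IsDivFree v)
    {core : Set (EuclideanSpace ℝ (Fin 3))} (hmeas : MeasurableSet core) {R : ℝ} (hR : 0 ≤ R)
    (hvol : volume core ≤ ENNReal.ofReal R)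
    {m M G : ℝ} (hm0 : 0 ≤ m) (hM0 : 0 ≤ M)
    (hMx : ∀ x, ‖v x‖ ≤ M) (hmx : ∀ x, x ∉ core → ‖v x‖ ≤ m)
    (hG : ∀ x, ‖fderiv ℝ v x‖ ≤ G)
    (iZ : Integrable (fun x => ‖curl v x‖ ^ 2))
    (iA : Integrable (fun x => frobeniusNormSq (fderiv ℝ (curl v) x)))
    (iJ : Integrable (fun x => ⟪curl v x, fderiv ℝ v x (curl v x)⟫)) :
    |∫ x, ⟪curl v x, fderiv ℝ v x (curl v x)⟫| ≤
      (m * Real.sqrt (∫ x, ‖curl v x‖ ^ 2) + M * (Real.sqrt 6 * G) * Real.sqrt R) *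
        Real.sqrt (∫ x, ‖curl (curl v) x‖ ^ 2) := by
  have hG0 : 0 ≤ G := (norm_nonneg _).trans (hG 0)
  have hvol_top : volume core ≠ ⊤ := (hvol.trans_lt ENNReal.ofReal_lt_top).ne
  have hvol_real : (volume core).toReal ≤ R := ENNReal.toReal_le_of_le_ofReal hR hvol
  -- the vorticity is bounded by `√6 G`
  have hωx : ∀ x, ‖curl v x‖ ≤ Real.sqrt 6 * G := by
    intro x
    have h1 : ‖curl v x‖ ^ 2 ≤ (Real.sqrt 6 * G) ^ 2 := by
      calc ‖curl v x‖ ^ 2 ≤ 2 * frobeniusNormSq (fderiv ℝ v x) :=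
            norm_curl_sq_le_two_mul_frobeniusNormSq v x
        _ ≤ 2 * (3 * ‖fderiv ℝ v x‖ ^ 2) := by
            gcongr; exact frobeniusNormSq_le_three_mul _
        _ ≤ 2 * (3 * G ^ 2) := by
            gcongr; exact hG x
        _ = (Real.sqrt 6 * G) ^ 2 := by
            rw [mul_pow, Real.sq_sqrt (by norm_num)]; ring
    exact (sq_le_sq₀ (norm_nonneg _) (by positivity)).1 h1
  -- Lamb form of the stretching integral
  rw [DepletionLadder.integral_stretching_eq_integral_inner_cross hv hdiv hMx iZ iA iJ]
  -- `L²` memberships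
  have mω : MemLp (fun x => ‖curl v x‖) 2 volume := DepletionLadder.memLp_two_norm_curl hv iZ
  have mcω : MemLp (fun x => ‖curl (curl v) x‖) 2 volume :=
    DepletionLadder.memLp_two_norm_curl_curl hv iA
  set c : ℝ := M * (Real.sqrt 6 * G) with hc_def
  have hc0 : 0 ≤ c := by positivity
  have mind : MemLp (core.indicator fun _ => c) 2 volume :=
    memLp_indicator_const 2 hmeas c (Or.inr hvol_top)
  -- the pointwise bound of the Lamb density
  have hpt : ∀ x, ‖⟪v x, cross (curl v x) (curl (curl v) x)⟫‖ ≤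
      m * (‖(fun y => ‖curl v y‖) x‖ * ‖(fun y => ‖curl (curl v) y‖) x‖) +
        ‖core.indicator (fun _ => c) x‖ * ‖(fun y => ‖curl (curl v) y‖) x‖ := by
    intro x
    simp only [norm_norm]
    have hcross : ‖cross (curl v x) (curl (curl v) x)‖ ≤ ‖curl v x‖ * ‖curl (curl v) x‖ := by
      rw [norm_cross]
      exact mul_le_of_le_one_right (by positivity) (Real.sin_le_one _)
    have h0 : ‖⟪v x, cross (curl v x) (curl (curl v) x)⟫‖ ≤
        ‖v x‖ * (‖curl v x‖ * ‖curl (curl v) x‖) :=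
      (norm_inner_le_norm _ _).trans (mul_le_mul_of_nonneg_left hcross (norm_nonneg _))
    by_cases hx : x ∈ core
    · rw [Set.indicator_of_mem hx, Real.norm_of_nonneg hc0]
      have h1 : ‖v x‖ * (‖curl v x‖ * ‖curl (curl v) x‖) ≤ c * ‖curl (curl v) x‖ := by
        rw [← mul_assoc, hc_def]
        exact mul_le_mul_of_nonneg_right
          (mul_le_mul (hMx x) (hωx x) (norm_nonneg _) hM0) (norm_nonneg _)
      have h2 : 0 ≤ m * (‖curl v x‖ * ‖curl (curl v) x‖) := by positivity
      linarith
    · rw [Set.indicator_of_notMem hx, norm_zero, zero_mul, add_zero]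
      exact h0.trans (mul_le_mul_of_nonneg_right (hmx x hx) (by positivity))
  -- integrate
  have iprod : Integrable (fun x => ‖(fun y => ‖curl v y‖) x‖ * ‖(fun y => ‖curl (curl v) y‖) x‖) :=
    mω.norm.integrable_mul mcω.norm
  have iind : Integrable
      (fun x => ‖core.indicator (fun _ => c) x‖ * ‖(fun y => ‖curl (curl v) y‖) x‖) :=
    mind.norm.integrable_mul mcω.norm
  have hI : ‖∫ x, ⟪v x, cross (curl v x) (curl (curl v) x)⟫‖ ≤
      ∫ x, (m * (‖(fun y => ‖curl v y‖) x‖ * ‖(fun y => ‖curl (curl v) y‖) x‖) +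
        ‖core.indicator (fun _ => c) x‖ * ‖(fun y => ‖curl (curl v) y‖) x‖) :=
    norm_integral_le_of_norm_le ((iprod.const_mul m).add iind) (Eventually.of_forall hpt)
  rw [integral_add (iprod.const_mul m) iind, integral_const_mul] at hI
  -- Cauchy–Schwarz, twice
  have hCS1 := integral_norm_mul_norm_le_sqrt_mul_sqrt mω mcω
  have hCS2 := integral_norm_mul_norm_le_sqrt_mul_sqrt mind mcω
  simp only [norm_norm] at hCS1 hCS2 hI
  -- the indicator integral
  have hind : ∫ x, ‖core.indicator (fun _ => c) x‖ ^ 2 = c ^ 2 * (volume core).toReal := by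
    have : (fun x => ‖core.indicator (fun _ => c) x‖ ^ 2) = core.indicator (fun _ => c ^ 2) := by
      funext x
      by_cases hx : x ∈ core
      · simp [Set.indicator_of_mem hx]
      · simp [Set.indicator_of_notMem hx]
    rw [this, integral_indicator_const _ hmeas, smul_eq_mul, mul_comm, measureReal_def]
  have hsq : Real.sqrt (∫ x, ‖core.indicator (fun _ => c) x‖ ^ 2) ≤ c * Real.sqrt R := by
    rw [hind, Real.sqrt_mul (sq_nonneg c), Real.sqrt_sq hc0]
    exact mul_le_mul_of_nonneg_left (Real.sqrt_le_sqrt hvol_real) hc0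
  have h2nd : ∫ x, ‖core.indicator (fun _ => c) x‖ * ‖curl (curl v) x‖ ≤
      c * Real.sqrt R * Real.sqrt (∫ x, ‖curl (curl v) x‖ ^ 2) :=
    hCS2.trans (mul_le_mul_of_nonneg_right hsq (Real.sqrt_nonneg _))
  have h1st : m * ∫ x, ‖curl v x‖ * ‖curl (curl v) x‖ ≤
      m * (Real.sqrt (∫ x, ‖curl v x‖ ^ 2) * Real.sqrt (∫ x, ‖curl (curl v) x‖ ^ 2)) :=
    mul_le_mul_of_nonneg_left hCS1 hm0
  rw [← Real.norm_eq_abs]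
  calc ‖∫ x, ⟪v x, cross (curl v x) (curl (curl v) x)⟫‖
      ≤ (m * ∫ x, ‖curl v x‖ * ‖curl (curl v) x‖) +
          ∫ x, ‖core.indicator (fun _ => c) x‖ * ‖curl (curl v) x‖ := hI
    _ ≤ m * (Real.sqrt (∫ x, ‖curl v x‖ ^ 2) * Real.sqrt (∫ x, ‖curl (curl v) x‖ ^ 2)) +
          c * Real.sqrt R * Real.sqrt (∫ x, ‖curl (curl v) x‖ ^ 2) :=
        add_le_add h1st h2nd
    _ = _ := by simp only [hc_def]; ring

/-! ### The engine -/

/-- **The sparse-core engine.** Let `(u, p)` be a classical solution of the unforced Navier–Stokes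
system (viscosity `ν > 0`) on `ℝ³ × [0,T)`, Leray–Hopf from its rapidly decaying datum, blowing up at
the sup-norm Type-I rate at `T` (`IsTypeIBlowup u T`). Suppose that for every `t ∈ (t₀, T)` there is
a measurable set `G ⊆ ℝ³` ("cores") with `|G| ≤ V √(T−t)³` such that
`‖u(t,x)‖ ≤ m₀ + μ/√(T−t)` for every `x ∉ G`, where `16 μ² ≤ ν`. Then Leray's quarter rate holds:
`∫ ‖curl u(t)‖² ≤ K/√(T−t)` for all `t ∈ [0,T)` and some `K`. (Global enstrophy identity; on the
cores the Type-I velocity rate, the KNSS gradient rate `‖∇u(t)‖_∞ ≤ C_g/(T−t)` and the volume give a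
forcing `K/(T−t)^{3/2}`; off the cores the smallness `4μ²/ν ≤ 1/4 < 1/2` of the singular Gronwall
coefficient integrates to the exponent `1/4`; bounded Sobolev norms on the initial interval.)
Bookkeeping along a hypothetical blow-up; nothing about Navier–Stokes regularity is asserted.
[cite: KochNadirashviliSereginSverak2009, §4 Prop. 4.1 (4.6) (arXiv:0709.3599v1 p. 8)] -/
theorem quarterLaw_of_sparseCores (ν T : ℝ) (hν : 0 < ν) (hT : 0 < T)
    (u : ℝ → EuclideanSpace ℝ (Fin 3) → EuclideanSpace ℝ (Fin 3))
    (p : ℝ → EuclideanSpace ℝ (Fin 3) → ℝ)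
    (hsol : IsClassicalNSSolutionOn (Ico 0 T) ν 0 u p) (hLH : IsLerayHopfOn T ν 0 (u 0) u)
    (hdec : HasRapidSpatialDecay (u 0)) (hI : IsTypeIBlowup u T)
    {t₀ m₀ μ V : ℝ} (ht₀T : t₀ < T) (hm₀ : 0 ≤ m₀) (hμ : 0 ≤ μ) (hμν : 16 * μ ^ 2 ≤ ν)
    (hV : 0 ≤ V)
    (hcore : ∀ t ∈ Ioo t₀ T, ∃ G : Set (EuclideanSpace ℝ (Fin 3)), MeasurableSet G ∧
      volume G ≤ ENNReal.ofReal (V * Real.sqrt (T - t) ^ 3) ∧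
      ∀ x, x ∉ G → ‖u t x‖ ≤ m₀ + μ / Real.sqrt (T - t)) :
    ∃ K : ℝ, ∀ t ∈ Ico 0 T,
      ∫⁻ x, ‖curl (u t) x‖ₑ ^ 2 ≤ ENNReal.ofReal (K / Real.sqrt (T - t)) := by
  -- the Chae/BKM class of the solution (Tao 2013 Cor. 11.1 via the tree's sub-slab cover)
  have hLS : Literature.Claims.NS.Chae2007.IsLocalSolution ν T (u 0) u p :=
    { isClassical := hsol
      initial := rfl
      sobolev := by
        intro T'' hT''
        have hT' : max T'' (T / 2) ∈ Ioo 0 T :=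
          ⟨lt_max_of_lt_right (half_pos hT), max_lt hT'' (half_lt_self hT)⟩
        obtain ⟨q, -, hB, -, -⟩ := RungReynoldsOne.stub_taoCover hν hT hsol hLH hdec hT'
        exact hB.mono (Icc_subset_Icc_right (le_max_left _ _)) }
  have hsT : ∀ t ∈ Ico 0 T, 0 < Real.sqrt (T - t) ∧ Real.sqrt (T - t) ≤ Real.sqrt T := fun t ht =>
    ⟨Real.sqrt_pos.2 (by linarith [ht.2]), Real.sqrt_le_sqrt (by linarith [ht.1])⟩
  -- Step 1a: the sup-norm Type-I rate on an interval `(tI, T)`, with a non-negative constant `B`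
  obtain ⟨Cg, hCg⟩ :=
    TypeIliouvilleNoTypeII.GradientPivot.stub_gradientSharp_of_typeI ν T hν hT u p hsol hLH hdec hI
  obtain ⟨CI, hCI⟩ := hI
  obtain ⟨tI, htIT, hIsub⟩ := mem_nhdsLT_iff_exists_Ioo_subset.1 hCI
  obtain ⟨B, hB_def⟩ : ∃ B : ℝ, B = max CI 0 := ⟨_, rfl⟩
  have hB0 : 0 ≤ B := by rw [hB_def]; exact le_max_right _ _
  have hCIB : CI ≤ B := by rw [hB_def]; exact le_max_left _ _
  -- Step 1b: the gradient rate near `T` (KNSS smoothing at the Type-I scale, tree)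
  obtain ⟨tg, htgT, hgsub⟩ := mem_nhdsLT_iff_exists_Ioo_subset.1 hCg
  obtain ⟨t₁, ht₁_def⟩ : ∃ t₁ : ℝ, t₁ = max (max tg tI) (max t₀ 0) := ⟨_, rfl⟩
  have ht₁T : t₁ < T := by
    rw [ht₁_def]; exact max_lt (max_lt htgT htIT) (max_lt ht₀T hT)
  have ht₁0 : 0 ≤ t₁ := by rw [ht₁_def]; exact le_max_of_le_right (le_max_right _ _)
  have ht₁g : tg ≤ t₁ := by rw [ht₁_def]; exact le_max_of_le_left (le_max_left _ _)
  have ht₁I : tI ≤ t₁ := by rw [ht₁_def]; exact le_max_of_le_left (le_max_right _ _)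
  have ht₁0' : t₀ ≤ t₁ := by rw [ht₁_def]; exact le_max_of_le_right (le_max_left _ _)
  have hgrad : ∀ t ∈ Ioo t₁ T, ∀ x, ‖fderiv ℝ (u t) x‖ ≤ Cg / (T - t) := fun t ht =>
    hgsub ⟨lt_of_le_of_lt ht₁g ht.1, ht.2⟩
  have hsup : ∀ t ∈ Ioo t₁ T, ∀ x, ‖u t x‖ ≤ B / Real.sqrt (T - t) := fun t ht x =>
    (hIsub ⟨lt_of_le_of_lt ht₁I ht.1, ht.2⟩ x).trans
      (div_le_div_of_nonneg_right hCIB (Real.sqrt_nonneg _))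
  -- Step 2: the enstrophy budget along the solution (tree: the classical enstrophy identity)
  obtain ⟨Zr, hZr_def⟩ : ∃ Zr : ℝ → ℝ, Zr = fun t => ∫ x, ‖curl (u t) x‖ ^ 2 := ⟨_, rfl⟩
  obtain ⟨Pr, hPr_def⟩ : ∃ Pr : ℝ → ℝ,
      Pr = fun t => ∫ x, frobeniusNormSq (fderiv ℝ (curl (u t)) x) := ⟨_, rfl⟩
  obtain ⟨Sr, hSr_def⟩ : ∃ Sr : ℝ → ℝ,
      Sr = fun t => ∫ x, ⟪curl (u t) x, fderiv ℝ (u t) x (curl (u t) x)⟫ := ⟨_, rfl⟩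
  have hZ : ∀ t ∈ Ioo 0 T, ∫⁻ x, ‖curl (u t) x‖ₑ ^ 2 = ENNReal.ofReal (Zr t) ∧ 0 ≤ Zr t ∧
      0 ≤ Pr t ∧ Pr t = ∫ x, frobeniusNormSq (fderiv ℝ (curl (u t)) x) ∧
      Sr t = ∫ x, ⟪curl (u t) x, fderiv ℝ (u t) x (curl (u t) x)⟫ ∧
      HasDerivAt Zr (2 * Sr t - 2 * ν * Pr t) t := by
    intro t ht
    have htI : t ∈ Ico 0 T := ⟨ht.1.le, ht.2⟩
    have hv2 : ContDiff ℝ 2 (u t) := (hsol.contDiff_velocity htI).of_le (by norm_cast)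
    have h1 : ∫⁻ x, ‖iteratedFDeriv ℝ 1 (u t) x‖ₑ ^ 2 < ⊤ := by
      have hT' : (t + T) / 2 < T := by linarith [ht.2]
      obtain ⟨C, hC⟩ := hLS.sobolev _ hT' 1
      exact (hC t ⟨ht.1.le, by linarith [ht.2]⟩).trans_lt ENNReal.coe_lt_top
    refine ⟨?_, ?_, ?_, ?_, ?_, ?_⟩
    · rw [hZr_def]; exact lintegral_enorm_curl_sq_eq_ofReal_integral hv2 h1
    · rw [hZr_def]; exact integral_nonneg fun x => sq_nonneg _
    · rw [hPr_def]; exact integral_nonneg fun x => frobeniusNormSq_nonneg _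
    · rw [hPr_def]
    · rw [hSr_def]
    · have hD := (LucardoOlivaes2026.hasDerivAt_half_ensq hν hLS ht).const_mul 2
      have hfun : (fun s => 2 * ((1 / 2 : ℝ) * Literature.Claims.NS.LucardoOlivaes2026.ensq u s)) =
          Zr := by
        funext s
        simp only [hZr_def, Literature.Claims.NS.LucardoOlivaes2026.ensq]
        ring
      rw [hfun] at hD
      refine hD.congr_deriv ?_
      simp only [hSr_def, hPr_def, Literature.Claims.NS.LucardoOlivaes2026.stretchI]
      ring
  -- the constants
  obtain ⟨a, ha_def⟩ : ∃ a : ℝ, a = 4 * m₀ ^ 2 / ν := ⟨_, rfl⟩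
  have ha : 0 ≤ a := by rw [ha_def]; positivity
  obtain ⟨K, hK_def⟩ : ∃ K : ℝ, K = 12 * B ^ 2 * Cg ^ 2 * V / ν := ⟨_, rfl⟩
  have hK : 0 ≤ K := by rw [hK_def]; positivity
  -- Steps 3–4: the differential inequality on `(t₁, T)`
  have hineq : ∀ t ∈ Ioo t₁ T,
      2 * Sr t - 2 * ν * Pr t ≤ a * Zr t + Zr t / (4 * (T - t)) + K / Real.sqrt (T - t) ^ 3 := by
    intro t ht
    have ht0T : t ∈ Ioo 0 T := ⟨lt_of_le_of_lt ht₁0 ht.1, ht.2⟩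
    have htI : t ∈ Ico 0 T := ⟨ht0T.1.le, ht.2⟩
    have ht₀t : t ∈ Ioo t₀ T := ⟨lt_of_le_of_lt ht₁0' ht.1, ht.2⟩
    have hTt : 0 < T - t := by linarith [ht.2]
    obtain ⟨hZeq, hZ0, hP0, hPeq, hSeq, -⟩ := hZ t ht0T
    -- the cores at time `t`
    obtain ⟨G, hGmeas, hGvol, hGoff⟩ := hcore t ht₀t
    -- `s = √(T−t)`
    obtain ⟨s, hs_def⟩ : ∃ s : ℝ, s = Real.sqrt (T - t) := ⟨_, rfl⟩
    have hs : 0 < s := by rw [hs_def]; exact Real.sqrt_pos.2 hTt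
    have hs2 : s ^ 2 = T - t := by rw [hs_def]; exact Real.sq_sqrt hTt.le
    rw [← hs_def] at hGvol hGoff ⊢
    -- the slice and its integrability (BKM class on `[0, (t+T)/2]`)
    have hv : ContDiff ℝ ∞ (u t) := hsol.contDiff_velocity htI
    have hv2 : ContDiff ℝ 2 (u t) := hv.of_le (by norm_cast)
    have hdiv : VectorCalculus.IsDivFree (u t) := hsol.divFree t htI
    have hT' : (t + T) / 2 < T := by linarith [ht.2]
    have hT'0 : 0 < (t + T) / 2 := by linarith [ht0T.1]
    have hsol' : IsClassicalNSSolutionOn (Icc 0 ((t + T) / 2)) ν 0 u p :=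
      hsol.mono (Icc_subset_Ico_right hT') (uniqueDiffOn_Icc hT'0)
    obtain ⟨iZ, iA, iJ⟩ := DepletionLadder.slice_integrability hsol' (hLS.sobolev _ hT')
      (t := t) ⟨ht0T.1.le, by linarith [ht.2]⟩
    -- `Zr t = ∫ ‖curl u(t)‖²`
    have hZr : Zr t = ∫ x, ‖curl (u t) x‖ ^ 2 := by rw [hZr_def]
    -- the slice estimate
    have hGt : ∀ x, ‖fderiv ℝ (u t) x‖ ≤ Cg / (T - t) := hgrad t ht
    have hCg0 : 0 ≤ Cg / (T - t) := (norm_nonneg _).trans (hGt 0)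
    have hMx : ∀ x, ‖u t x‖ ≤ B / s := by intro x; rw [hs_def]; exact hsup t ht x
    obtain ⟨m, hm_def⟩ : ∃ m : ℝ, m = m₀ + μ / s := ⟨_, rfl⟩
    have hm0 : 0 ≤ m := by rw [hm_def]; positivity
    have hmx : ∀ x, x ∉ G → ‖u t x‖ ≤ m := by intro x hx; rw [hm_def]; exact hGoff x hx
    obtain ⟨R, hR_def⟩ : ∃ R : ℝ, R = V * s ^ 3 := ⟨_, rfl⟩
    have hR0 : 0 ≤ R := by rw [hR_def]; positivity
    have hvolR : volume G ≤ ENNReal.ofReal R := by rw [hR_def]; exact hGvol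
    obtain ⟨A₁, hA₁_def⟩ : ∃ A₁ : ℝ, A₁ = m * Real.sqrt (Zr t) := ⟨_, rfl⟩
    obtain ⟨A₂, hA₂_def⟩ : ∃ A₂ : ℝ,
        A₂ = B / s * (Real.sqrt 6 * (Cg / (T - t))) * Real.sqrt R := ⟨_, rfl⟩
    have hA₁0 : 0 ≤ A₁ := by rw [hA₁_def]; positivity
    have hA₂0 : 0 ≤ A₂ := by rw [hA₂_def]; positivity
    have hslice : |Sr t| ≤ (A₁ + A₂) * Real.sqrt (∫ x, ‖curl (curl (u t)) x‖ ^ 2) := by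
      rw [hSeq, hA₁_def, hA₂_def, hZr]
      exact slice_stretching_bound_core hv2 hdiv hGmeas hR0 hvolR hm0 (by positivity) hMx hmx
        hGt iZ iA iJ
    -- `‖curl ω‖₂² ≤ 2 P`
    have hW : ∫ x, ‖curl (curl (u t)) x‖ ^ 2 ≤ 2 * Pr t := by
      rw [hPeq, ← integral_const_mul]
      exact integral_mono_of_nonneg (Eventually.of_forall fun x => sq_nonneg _) (iA.const_mul 2)
        (Eventually.of_forall fun x => norm_curl_sq_le_two_mul_frobeniusNormSq (curl (u t)) x)
    -- Young
    have hY := young_budget hν hA₁0 hA₂0 hP0 hslice hW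
    -- `2A₁²/ν ≤ a Z + Z/(4(T−t))`
    have h1 : 2 * A₁ ^ 2 / ν ≤ a * Zr t + Zr t / (4 * (T - t)) := by
      have hm2 : m ^ 2 ≤ 2 * m₀ ^ 2 + 2 * (μ / s) ^ 2 := by
        rw [hm_def]; nlinarith only [sq_nonneg (m₀ - μ / s)]
      have e1 : A₁ ^ 2 = m ^ 2 * Zr t := by rw [hA₁_def, mul_pow, Real.sq_sqrt hZ0]
      have hkey : 2 * (2 * (μ / s) ^ 2) / ν ≤ 1 / (4 * (T - t)) := by
        rw [div_pow, hs2, div_le_div_iff₀ hν (by positivity)]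
        have : 2 * (2 * (μ ^ 2 / (T - t))) * (4 * (T - t)) = 16 * μ ^ 2 := by
          field_simp
          ring
        rw [this, one_mul]
        exact hμν
      calc 2 * A₁ ^ 2 / ν = 2 * m ^ 2 / ν * Zr t := by rw [e1]; ring
        _ ≤ 2 * (2 * m₀ ^ 2 + 2 * (μ / s) ^ 2) / ν * Zr t := by gcongr
        _ = a * Zr t + (2 * (2 * (μ / s) ^ 2) / ν) * Zr t := by rw [ha_def]; ring
        _ ≤ a * Zr t + 1 / (4 * (T - t)) * Zr t := by gcongr
        _ = a * Zr t + Zr t / (4 * (T - t)) := by ring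
    -- `2A₂²/ν = K/s³`
    have h2 : 2 * A₂ ^ 2 / ν ≤ K / s ^ 3 := by
      have hRs : Real.sqrt R ^ 2 = V * s ^ 3 := by rw [Real.sq_sqrt hR0, hR_def]
      have h6 : Real.sqrt 6 ^ 2 = 6 := Real.sq_sqrt (by norm_num)
      have hν0 : ν ≠ 0 := hν.ne'
      have hs0 : s ≠ 0 := hs.ne'
      have e2 : 2 * A₂ ^ 2 / ν = K / s ^ 3 := by
        rw [hA₂_def, hK_def]
        simp only [mul_pow, div_pow, h6, hRs, ← hs2]
        field_simp
        ring
      exact e2.le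
    calc 2 * Sr t - 2 * ν * Pr t ≤ 2 * (A₁ ^ 2 + A₂ ^ 2) / ν := hY
      _ = 2 * A₁ ^ 2 / ν + 2 * A₂ ^ 2 / ν := by ring
      _ ≤ (a * Zr t + Zr t / (4 * (T - t))) + K / s ^ 3 := add_le_add h1 h2
  -- Step 5: Gronwall near `T`
  have hder : ∀ t ∈ Ioo t₁ T, HasDerivAt Zr (2 * Sr t - 2 * ν * Pr t) t := fun t ht =>
    (hZ t ⟨lt_of_le_of_lt ht₁0 ht.1, ht.2⟩).2.2.2.2.2
  have hZ0' : ∀ t ∈ Ioo t₁ T, 0 ≤ Zr t := fun t ht => (hZ t ⟨lt_of_le_of_lt ht₁0 ht.1, ht.2⟩).2.1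
  obtain ⟨K₁, hK₁⟩ := gronwall_quarter (φ := Zr) (dφ := fun t => 2 * Sr t - 2 * ν * Pr t)
    ht₁T ha hK hZ0' hder hineq
  -- the initial interval `[0, t₂]`: bounded Sobolev norms
  obtain ⟨t₂, ht₂_def⟩ : ∃ t₂ : ℝ, t₂ = (t₁ + T) / 2 := ⟨_, rfl⟩
  have ht₂T : t₂ < T := by rw [ht₂_def]; linarith
  have ht₂0 : 0 < t₂ := by rw [ht₂_def]; linarith
  obtain ⟨C₁, hC₁⟩ := hLS.sobolev t₂ ht₂T 1
  have hinit : ∀ t ∈ Icc 0 t₂, ∫⁻ x, ‖curl (u t) x‖ₑ ^ 2 ≤ 6 * (C₁ : ℝ≥0∞) := fun t ht =>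
    calc ∫⁻ x, ‖curl (u t) x‖ₑ ^ 2 ≤ ∫⁻ x, 6 * ‖iteratedFDeriv ℝ 1 (u t) x‖ₑ ^ 2 :=
          lintegral_mono fun x => RungReynoldsOne.enorm_curl_sq_le_six_mul (u t) x
      _ = 6 * ∫⁻ x, ‖iteratedFDeriv ℝ 1 (u t) x‖ₑ ^ 2 := lintegral_const_mul' _ _ (by norm_num)
      _ ≤ 6 * C₁ := by gcongr; exact hC₁ t ht
  obtain ⟨K₂, hK₂_def⟩ : ∃ K₂ : ℝ, K₂ = 6 * (C₁ : ℝ) * Real.sqrt T := ⟨_, rfl⟩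
  refine ⟨max K₁ K₂, fun t ht => ?_⟩
  obtain ⟨hs, hsT'⟩ := hsT t ht
  by_cases htc : t₂ ≤ t
  · -- Gronwall regime
    have ht0T : t ∈ Ioo 0 T := ⟨lt_of_lt_of_le ht₂0 htc, ht.2⟩
    rw [(hZ t ht0T).1]
    exact ENNReal.ofReal_le_ofReal
      ((hK₁ t ⟨ht₂_def ▸ htc, ht.2⟩).trans (div_le_div_of_nonneg_right (le_max_left _ _) hs.le))
  · -- initial regime
    push Not at htc
    have h6 : (6 : ℝ≥0∞) * C₁ = ENNReal.ofReal (6 * (C₁ : ℝ)) := by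
      rw [ENNReal.ofReal_mul (by norm_num), ENNReal.ofReal_coe_nnreal, ENNReal.ofReal_ofNat]
    calc ∫⁻ x, ‖curl (u t) x‖ₑ ^ 2 ≤ 6 * (C₁ : ℝ≥0∞) := hinit t ⟨ht.1, htc.le⟩
      _ = ENNReal.ofReal (6 * (C₁ : ℝ)) := h6
      _ ≤ ENNReal.ofReal (max K₁ K₂ / Real.sqrt (T - t)) := by
          refine ENNReal.ofReal_le_ofReal ?_
          rw [le_div_iff₀ hs]
          have hC₁0 : 0 ≤ (C₁ : ℝ) := C₁.2
          calc 6 * (C₁ : ℝ) * Real.sqrt (T - t) ≤ 6 * (C₁ : ℝ) * Real.sqrt T := by gcongr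
            _ = K₂ := by rw [hK₂_def]
            _ ≤ max K₁ K₂ := le_max_right _ _

end CountQuarterLaw

end Summit.NavierStokesRegularity.NavierStokesRegularity.Theorems

end
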